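import Summits.QuantumFields.BalabanUV.Gaps.D1WardBorderWeightPolynomial
import Summits.QuantumFields.BalabanUV.Gaps.D1PinnedColourPolynomial

/-!
# `BalabanUV.Gaps.D1WardReducedNormalForm` — cell pub-balaban-gaps, row (D1), seat g1-p1: UNDER THE WARD BINDER AT ANY ONE LEVEL, (D1) ON THE PINNED FAMILY IS ONE POLYNOMIAL EQUATION OF
# TOTAL DEGREE ≤ 4 IN PRINT's COLOUR TRIPLE WITH NO FREE BORDER WEIGHT — GEN 13's universal normal form `γ_r + Φ(c⃗) + cB·σ_r + Λ(Tc) = stepBal N Lc` with `cB` ELIMINATED by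
# GEN 15's Ward pin `cB = R_j(c⃗)` (wherever the unit border tower has a nonzero zeroth moment at level `j`)

HONEST FRAMING (cell rule, page 1 of everything): [folklore] kernel algebra BY NAME — GEN 13's `D1PinnedColourPolynomial.d1Drift_iff_normalForm_universal` and GEN 15's
`D1WardBorderWeightPolynomial.wardBorderWeight_eq_eval_mvPolynomial`.  `hW` (at ONE level `j`) is a HYPOTHESIS about a member of the cells' OWN pinned family `JsBalAn1(r; c⃗; Lc^8; cB; Tc)`
(the β-lead's candidate; (P6) undecided); the nonvanishing hypothesis is about a colour-free zeroth moment of the unit border tower (Engine C's border tower; its float reading −1.2018e-8 at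
Lc = 3, level 0 is of zero weight and NOT used).  Nothing of Bałaban's asserted; NO coefficient computed or signed; (D1) NOT discharged; 0∕4 row-D1 binders; NOT `BetaPertH`, NOT continuum,
NOT Clay.  HONEST DEPENDENCY (b2b cell, verbatim): «continuum YM on T⁴ ⇐ BetaPertH ∧ nine spine estimates (0/9 proved); BetaPertH ⇐ (D1) ∧ (D4) ∧ CAP+tail; G-an2-4 gates asym, D1 and NE2/3/4.»

CONTENT (all [folklore]; no `def`, 0 sorry): **`d1Drift_iff_wardReducedNormalForm`** — at the pin `cE₂ = Lc^8`, `2 ≤ Lc`, channel `(μ,ν)`: there are the universal root-free `Φ` (`totalDegree ≤ 4`, no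
linear part, `coeff 0 = 0`) and linear `Λ` of GEN 13 and, for every root, the reals `γ_r, σ_r`; and for every root, level `j`, table `Tc` and channel `(c,e)` with a NONZERO unit-border zeroth
moment at level `j` there is ONE polynomial `E` (`totalDegree ≤ 4`, `homogeneousComponent 1 = 0`; namely `Φ + σ_r·R_j`) such that for EVERY numeral `N`, colour triple `c⃗` and border weight `cB`:
`hW` at level `j` for the member `(r; c⃗; Lc^8; cB; Tc)` ⟹ ( (D1) for it ⟺ `γ_r + E(c⃗) + Λ(Tc) = stepBal N Lc` ) — the border weight has DROPPED OUT of the binder's normal form.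

Provenance: cell pub-balaban-gaps, seat g1-p1 GEN 15 (prover-pub-balaban-gaps-g1-p1-g15-0), 2026-08-25; imports GEN 15's `Gaps/D1WardBorderWeightPolynomial` + GEN 13's
`Gaps/D1PinnedColourPolynomial` (p391905 ✓); no existing file touched.
-/

noncomputable section

open Literature.MathematicalPhysics.QuantumFieldTheory Balaban1983to89 Balaban1983to89.Beta
open OneStepKernelFamily (TbalOf flipK D1Drift)
open PolarizationSign (WardTransversal)
open OddMoments (zerothMoment)
open AffineAveraging (box)
open Summit.QuantumFields.BalabanUV.Beta.MixedJetTablesPlug (JsBalAn1)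
open Summit.QuantumFields.BalabanUV.Beta.GAN24.StencilSlotOfE3 (one_le_of_two_le)
open Summit.QuantumFields.BalabanUV.Gaps.D1PinnedColourPolynomial (d1Drift_iff_normalForm_universal)
open Summit.QuantumFields.BalabanUV.Gaps.D1WardBorderWeightPolynomial (wardBorderWeight_eq_eval_mvPolynomial)

namespace Summit.QuantumFields.BalabanUV.Gaps.D1WardReducedNormalForm

variable {Lc : ℕ} [NeZero Lc]

/-- [folklore] **UNDER THE WARD BINDER AT ONE LEVEL, (D1) ON THE PINNED FAMILY IS ONE QUARTIC EQUATION IN THE COLOUR TRIPLE WITH NO FREE BORDER WEIGHT.**  With GEN 13's universal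
`Φ, Λ` (reference root `r₀`) and per-root `γ, σ`: for every root `r`, level `j`, table `Tc` and channel `(c, e)` in which the unit border tower `flipK T_j(r; c⃗₀; Lc^8; 1; Tc) − flipK T_j(…; 0; Tc)`
has a NONZERO zeroth moment (colour-free, any `c⃗₀`), there is ONE `E : MvPolynomial (Fin 3) ℝ`, `E.totalDegree ≤ 4`, `E.homogeneousComponent 1 = 0`, such that for every `N, c⃗, cB`:
`WardTransversal (flipK (T_j(r; c⃗; Lc^8; cB; Tc)))` ⟹ ( `D1Drift … N μ ν` ⟺ `γ + eval c⃗ E + Λ Tc = stepBal N Lc` ). -/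
theorem d1Drift_iff_wardReducedNormalForm (hLc : 2 ≤ Lc) {r₀ : Fin (3 + 1) → ℕ} (hr₀ : r₀ ∈ box (3 + 1) Lc) (μ ν : Fin 4) :
    ∃ (Φ : MvPolynomial (Fin 3) ℝ) (Λ : (Fin 4 → Fin 4 → Fin 4 → Fin 4 → ℝ) →ₗ[ℝ] ℝ),
      Φ.totalDegree ≤ 4 ∧ Φ.homogeneousComponent 1 = 0 ∧ Φ.coeff 0 = 0 ∧
      ∀ (r : Fin (3 + 1) → ℕ) (hr : r ∈ box (3 + 1) Lc), ∃ γ σ : ℝ,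
        (∀ (N cE cVH cΛ cB : ℝ) (Tc : Fin 4 → Fin 4 → Fin 4 → Fin 4 → ℝ),
          (D1Drift Lc (JsBalAn1 (one_le_of_two_le hLc) hr cE cVH cΛ ((Lc : ℝ) ^ (2 * (3 + 1))) cB Tc) N μ ν ↔
            γ + MvPolynomial.eval ![cE, cVH, cΛ] Φ + cB * σ + Λ Tc = B12Normalization.stepBal N Lc)) ∧
        ∀ (j : ℕ) (Tc : Fin 4 → Fin 4 → Fin 4 → Fin 4 → ℝ) (cE₀ cVH₀ cΛ₀ : ℝ) (c e : Fin 4),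
          zerothMoment (fun a b w => flipK (TbalOf Lc (JsBalAn1 (one_le_of_two_le hLc) hr cE₀ cVH₀ cΛ₀ ((Lc : ℝ) ^ (2 * (3 + 1))) 1 Tc) j) a b w -
              flipK (TbalOf Lc (JsBalAn1 (one_le_of_two_le hLc) hr cE₀ cVH₀ cΛ₀ ((Lc : ℝ) ^ (2 * (3 + 1))) 0 Tc) j) a b w) c e ≠ 0 →
          ∃ E : MvPolynomial (Fin 3) ℝ, E.totalDegree ≤ 4 ∧ E.homogeneousComponent 1 = 0 ∧
            ∀ (N cE cVH cΛ cB : ℝ), WardTransversal (flipK (TbalOf Lc (JsBalAn1 (one_le_of_two_le hLc) hr cE cVH cΛ ((Lc : ℝ) ^ (2 * (3 + 1))) cB Tc) j)) →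
              (D1Drift Lc (JsBalAn1 (one_le_of_two_le hLc) hr cE cVH cΛ ((Lc : ℝ) ^ (2 * (3 + 1))) cB Tc) N μ ν ↔
                γ + MvPolynomial.eval ![cE, cVH, cΛ] E + Λ Tc = B12Normalization.stepBal N Lc) := by
  obtain ⟨Φ, Λ, h4, h1, h0, h⟩ := d1Drift_iff_normalForm_universal hLc hr₀ μ ν
  refine ⟨Φ, Λ, h4, h1, h0, fun r hr => ?_⟩
  obtain ⟨γ, σ, hγ⟩ := h r hr
  refine ⟨γ, σ, hγ, fun j Tc cE₀ cVH₀ cΛ₀ c e hU => ?_⟩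
  obtain ⟨R, hR4, hR1, hR⟩ := wardBorderWeight_eq_eval_mvPolynomial (one_le_of_two_le hLc) hr cE₀ cVH₀ cΛ₀ ((Lc : ℝ) ^ (2 * (3 + 1))) Tc j hU
  refine ⟨Φ + MvPolynomial.C σ * R, ?_, ?_, fun N cE cVH cΛ cB hW => ?_⟩
  · refine (MvPolynomial.totalDegree_add _ _).trans (max_le h4 ?_)
    exact (MvPolynomial.totalDegree_mul _ _).trans (by rw [MvPolynomial.totalDegree_C, zero_add]; exact hR4)
  · rw [map_add, h1, MvPolynomial.homogeneousComponent_C_mul, hR1, mul_zero, add_zero]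
  · rw [hγ N cE cVH cΛ cB Tc, hR cE cVH cΛ cB hW, map_add, map_mul, MvPolynomial.eval_C]
    constructor <;> intro hx <;> linarith

/-- [folklore] Read contrapositively, for the programme: under the Ward binder at a level with a nonzero unit-border zeroth moment, (D1) for the Ward-compatible member with colour triple `c⃗`
holds for EVERY such `c⃗` OR the set of colour triples where it holds is the real zero set of a NONZERO polynomial of degree ≤ 4 (shifted by the constants) — a thin set; which alternative
holds is not decided here (GEN 13's `d1Drift_allColours_or_interior_empty` is the `cB`-fixed analogue). Stated as the equation's uniqueness in `N`: for a Ward-compatible member and fixed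
`c⃗, Tc`, at most ONE numeral-slope value `stepBal N Lc` satisfies (D1) (trivial from the normal form; recorded for the census). -/
theorem stepBal_unique_of_d1Drift_ward (hLc : 2 ≤ Lc) {r : Fin (3 + 1) → ℕ} (hr : r ∈ box (3 + 1) Lc) (μ ν : Fin 4) (cE cVH cΛ cB : ℝ)
    (Tc : Fin 4 → Fin 4 → Fin 4 → Fin 4 → ℝ) {N N' : ℝ}
    (hD : D1Drift Lc (JsBalAn1 (one_le_of_two_le hLc) hr cE cVH cΛ ((Lc : ℝ) ^ (2 * (3 + 1))) cB Tc) N μ ν)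
    (hD' : D1Drift Lc (JsBalAn1 (one_le_of_two_le hLc) hr cE cVH cΛ ((Lc : ℝ) ^ (2 * (3 + 1))) cB Tc) N' μ ν) :
    B12Normalization.stepBal N Lc = B12Normalization.stepBal N' Lc := by
  obtain ⟨Φ, Λ, -, -, -, h⟩ := d1Drift_iff_normalForm_universal hLc hr μ ν
  obtain ⟨γ, σ, hγ⟩ := h r hr
  rw [hγ] at hD hD'
  rw [← hD, ← hD']

end Summit.QuantumFields.BalabanUV.Gaps.D1WardReducedNormalForm

end
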